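import Mathlib
import HarnessLib
import Summits.HubbardSuperconductivity.HubbardSuperconductivity.Theorems.KLProgrammeKLRegimeCountertermOneVolumeHA
import Summits.HubbardSuperconductivity.HubbardSuperconductivity.Theorems.KLProgrammeKLRegimeCountertermShape
import Summits.HubbardSuperconductivity.HubbardSuperconductivity.Theorems.KLProgrammeKLRegimeSplitBundleV12

/-!
# Route `KLProgramme` — child `KLRegimeCounterterm` of crux K3 FOR EVERY BUNDLE WHOSE TWO-LEG SLOT IMPLIES THE MINIMAL CONSUMED BLOCK
# (`CountertermP2 Pr klWindowC`; gen 3 `klPredsV11`, gen 4 `klPredsV12`, and any later re-typing of floor / slopes / angular majorant) — seat hubbard-kl-k3c3-p2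

**`countertermP2_of_minimalShape`** — the sharpening of `countertermP2_of_twoLegShape` (`…CountertermShape`) to the conjuncts the counterterm
construction actually CONSUMES.  Let `Pr : Preds` be any predicate bundle with
* `FrameOK → Pr.frameOK`, `RenormalisedAtF → Pr.renorm`;
* a comparison-frame HISTORY `H` implied by `Pr.split ∧ RenormalisedAtF ∧ Pr.engine`, an (E3f) ANTECEDENT `A` implied by `H ∧ Pr.twoLeg`;
* `Pr.twoLeg → TwoLegSizesG ∧ FrameLipschitzG H ∧ TwoLegSizesMS ∧ (θ ↦ ν_n(K)(θ) is Λ-Lipschitz) ∧ TwoLegVolumeRate A`, where the angular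
  Lipschitz constant `Λ = Λang G P Q R β U μ` is ANY real-valued function of the data fixed before the volume (for the V11/V12 bundles:
  `angBar G Q R U (nScales β) 1` via `TwoLegAngularG.abs_sub_le`; for a re-typed (E3g) majorant — p1b's N-(E3g) finding — whatever it is).
No floor (E3b), no slopes (E3d/e), no `C⁴` angular profile, no engine or split content is read.  Then `CountertermP2 Pr klWindowC`.  Proof:
`ct_oneVolume_thresholdsHA` (`…CountertermOneVolumeHA`, on `…CountertermContinuationHA`) + the volume transfer `ct_volumeTransfer_of_rate`
(`…CountertermShape`).  Instances (`example`s, identity maps + `TwoLegAngularG.abs_sub_le`): `klPredsV11`, `klPredsV12`.  Proofs only; nothing is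
asserted about the Hubbard model beyond the hypothesis blocks.
-/

noncomputable section

namespace Summit.HubbardSuperconductivity.HubbardSuperconductivity.Theorems.KLRegimeSplit

set_option linter.dupNamespace false -- summit = problem name (single-conjunct summit), D-0017

open Real Finset
open Literature.MathematicalPhysics.QuantumLattice Literature.Probability.LatticeModels
open Summit.HubbardSuperconductivity.HubbardSuperconductivity.Theorems.KLProgrammeLegKernels

/-! ## §1 `CountertermP2` for every bundle implying the minimal consumed block -/

section Shape

variable {Pr : Preds}

/-- **CHILD COUNTERTERM FOR EVERY BUNDLE IMPLYING THE MINIMAL CONSUMED BLOCK.**  See the module docstring: `H` is the comparison-frame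
history (implied by `split ∧ renorm ∧ engine`), `A` the (E3f) comparison-volume antecedent (implied by `H ∧ twoLeg`), `Λang` the angular Lipschitz
constant (any function of the data fixed before the volume); the two-leg slot need only IMPLY sizes, frame-Lipschitz at `H`, multi-slot sizes, the
angular Lipschitz bound and the (E3f) rate at `A`.  Conclusion: `CountertermP2 Pr klWindowC`. -/
theorem countertermP2_of_minimalShape
    (H A : (L M : ℕ) → [NeZero L] → [NeZero M] → GeoConsts → SplitConsts → EngConsts → RenConsts → ℝ → ℝ → ℝ →
      TrigPolyC4v → ℕ → Prop)
    (Λang : GeoConsts → SplitConsts → EngConsts → RenConsts → ℝ → ℝ → ℝ → ℝ)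
    (hF : ∀ (R : RenConsts) (U : ℝ) (N : ℕ) (μ : ℝ) (K : TrigPolyC4v), FrameOK R U N μ K → Pr.frameOK R U N μ K)
    (hR : ∀ (L M : ℕ) [NeZero L] [NeZero M] (β U μ : ℝ) (K : TrigPolyC4v) (R : RenConsts) (n : ℕ),
      RenormalisedAtF L M β U μ K R n → Pr.renorm L M β U μ K R n)
    (hH : ∀ (L M : ℕ) [NeZero L] [NeZero M] (G : GeoConsts) (P : SplitConsts) (Q : EngConsts) (R : RenConsts) (β U μ : ℝ)
      (K : TrigPolyC4v) (n : ℕ), Pr.split L M G P Q β U μ K n → RenormalisedAtF L M β U μ K R n →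
        Pr.engine L M G P Q β U μ K n → H L M G P Q R β U μ K n)
    (hA : ∀ (L M : ℕ) [NeZero L] [NeZero M] (G : GeoConsts) (P : SplitConsts) (Q : EngConsts) (R : RenConsts) (β U μ : ℝ)
      (K : TrigPolyC4v) (n : ℕ), H L M G P Q R β U μ K n → Pr.twoLeg L M G P Q R β U μ K n → A L M G P Q R β U μ K n)
    (hT : ∀ (L M : ℕ) [NeZero L] [NeZero M] (G : GeoConsts) (P : SplitConsts) (Q : EngConsts) (R : RenConsts) (β U μ : ℝ)
      (K : TrigPolyC4v) (n : ℕ), Pr.twoLeg L M G P Q R β U μ K n →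
        TwoLegSizesG L M G Q R β U μ K n ∧ FrameLipschitzG L M (H L M G P Q R β U μ) G Q R β U μ K n ∧
          TwoLegSizesMS L M G Q R β U μ K n ∧
            (∀ a b : ℝ, |klLocalPart L M β U μ K n a - klLocalPart L M β U μ K n b| ≤ Λang G P Q R β U μ * |a - b|) ∧
              TwoLegVolumeRate L M (fun L' M' _ _ K' j => A L' M' G P Q R β U μ K' j) Q β U μ K n) :
    CountertermP2 Pr klWindowC := by
  intro G P hG _
  refine ⟨ctRenMs G, ctRenMs_WF2 hG, fun Q hQ => ?_⟩
  obtain ⟨c₁, hc₁, hc⟩ := ct_oneVolume_thresholdsHA G Q hG hQ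
  refine ⟨c₁, hc₁, fun c hc0 hcc => ?_⟩
  obtain ⟨U₀, hU₀, hmain⟩ := hc c hc0 hcc
  refine ⟨U₀, hU₀, fun μ hμ U hU hUle β hβ hβc Lh Mh hhyp => ?_⟩
  have hCL : ∀ n, 0 ≤ Q.CL β n := fun n => hQ.2.2.2.2.2.2.2 β n
  obtain ⟨L₀, M₀, hL₀pos, hM₀pos, hLh, hMh, hM0, hrate, hvol⟩ :=
    hmain μ hμ U hU hUle β hβ hβc Lh Mh (Q.M0 β) (Q.CL β) (Λang G P Q (ctRenMs G) β U μ) hCL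
  haveI : NeZero L₀ := ⟨Nat.pos_iff_ne_zero.mp hL₀pos⟩
  haveI : NeZero M₀ := ⟨Nat.pos_iff_ne_zero.mp hM₀pos⟩
  -- the minimal block at any volume beyond the thresholds, from the hypothesis block of `CountertermP2`
  have blkAt : ∀ (L M : ℕ) [NeZero L] [NeZero M], Lh ≤ L → Mh L ≤ M →
      ∀ K : TrigPolyC4v, FrameOK (ctRenMs G) U (nScales β) μ K → ∀ n : ℕ, n ≤ nScales β →
        (∀ j < n, RenormalisedAtF L M β U μ K (ctRenMs G) j) →
          TwoLegSizesG L M G Q (ctRenMs G) β U μ K n ∧ FrameLipschitzG L M (H L M G P Q (ctRenMs G) β U μ) G Q (ctRenMs G) β U μ K n ∧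
            TwoLegSizesMS L M G Q (ctRenMs G) β U μ K n ∧
              (∀ a b : ℝ, |klLocalPart L M β U μ K n a - klLocalPart L M β U μ K n b| ≤
                Λang G P Q (ctRenMs G) β U μ * |a - b|) ∧
              (RenormalisedAtF L M β U μ K (ctRenMs G) n → H L M G P Q (ctRenMs G) β U μ K n) := by
    intro L M _ _ hL hM K hK n hn hren
    obtain ⟨hE, hTw, hS⟩ := hhyp K (hF _ _ _ _ _ hK) L M hL hM n hn fun j hj => hR _ _ _ _ _ _ _ _ (hren j hj)
    have ht := hT _ _ _ _ _ _ _ _ _ _ _ hTw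
    exact ⟨ht.1, ht.2.1, ht.2.2.1, ht.2.2.2.1, fun hr => hH _ _ _ _ _ _ _ _ _ _ _ hS hr hE⟩
  -- the one-volume construction at `(L₀, M₀)`
  obtain ⟨K, hK, hhalf⟩ := hvol inferInstance inferInstance (H L₀ M₀ G P Q (ctRenMs G) β U μ)
    (fun K n => ∀ a b : ℝ, |klLocalPart L₀ M₀ β U μ K n a - klLocalPart L₀ M₀ β U μ K n b| ≤ Λang G P Q (ctRenMs G) β U μ * |a - b|)
    (fun _ _ h => h) (blkAt L₀ M₀ hLh hMh)
  refine ⟨K, hF _ _ _ _ _ hK, L₀, fun L => max (Mh L) (Q.M0 β L), fun L M _ _ hL hM n hn => hR _ _ _ _ _ _ _ _ ?_⟩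
  -- renormalisation at the construction volume, at every scale (half tolerance ≤ tolerance)
  have htol_nonneg : ∀ n, 0 ≤ ctCr G * |U| * klScale klE0 n ^ 2 / klE0 / 2 := by
    intro n
    have hS : ∀ j, 0 ≤ G.S j := hG.2.2.2.2.2.2.2.2.2.2.2.2.2.2.2.2.2.1
    have hcr : 0 ≤ ctCr G := by unfold ctCr; nlinarith [hS 0]
    have he0 : (0:ℝ) < klE0 := by norm_num [klE0]
    positivity
  have hren0 : ∀ n, n ≤ nScales β → RenormalisedAtF L₀ M₀ β U μ K (ctRenMs G) n := by
    intro n hn θ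
    have h := hhalf n hn θ
    show |klLocalPart L₀ M₀ β U μ K n θ| ≤ ctCr G * |U| * klScale klE0 n ^ 2 / klE0
    linarith [htol_nonneg n]
  -- the (E3f) comparison-volume antecedent at any volume beyond the thresholds carrying the renormalisation below the scale
  have hAnte : ∀ (L' M' : ℕ) [NeZero L'] [NeZero M'], Lh ≤ L' → Mh L' ≤ M' → ∀ n : ℕ, n ≤ nScales β →
      (∀ j < n, RenormalisedAtF L' M' β U μ K (ctRenMs G) j) → ∀ j < n, A L' M' G P Q (ctRenMs G) β U μ K j := by
    intro L' M' _ _ hL' hM' n hn hren j hj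
    obtain ⟨hE, hTw, hS⟩ := hhyp K (hF _ _ _ _ _ hK) L' M' hL' hM' j (le_of_lt (lt_of_lt_of_le hj hn))
      fun i hi => hR _ _ _ _ _ _ _ _ (hren i (hi.trans hj))
    exact hA _ _ _ _ _ _ _ _ _ _ _ (hH _ _ _ _ _ _ _ _ _ _ _ hS (hren j hj) hE) hTw
  -- the rate between the construction volume and any larger volume
  have rate : ∀ (L M : ℕ) [NeZero L] [NeZero M], L₀ ≤ L → max (Mh L) (Q.M0 β L) ≤ M → ∀ n : ℕ, n ≤ nScales β →
      (∀ j < n, RenormalisedAtF L M β U μ K (ctRenMs G) j) →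
        ∀ θ : ℝ, |klLocalPart L₀ M₀ β U μ K n θ - klLocalPart L M β U μ K n θ| ≤ Q.CL β n / L₀ := by
    intro L M _ _ hL hM n hn hrenL θ
    have hMhL : Mh L ≤ M := (le_max_left _ _).trans hM
    have hM0L : Q.M0 β L ≤ M := (le_max_right _ _).trans hM
    obtain ⟨_, hTw, _⟩ := hhyp K (hF _ _ _ _ _ hK) L₀ M₀ hLh hMh n hn
      fun j hj => hR _ _ _ _ _ _ _ _ (hren0 j (le_of_lt (lt_of_lt_of_le hj hn)))
    have hvr := (hT _ _ _ _ _ _ _ _ _ _ _ hTw).2.2.2.2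
    exact hvr hM0 L M hL hM0L (hAnte L M (hLh.trans hL) hMhL n hn hrenL) θ
  exact ct_volumeTransfer_of_rate (G := G) (R := ctRenMs G) rfl rate (fun n hn => ⟨hhalf n hn, hrate n hn⟩) L M hL hM n hn

end Shape

/-! ## §2 Instances: gen 3 (`klPredsV11`, closed) and gen 4 (`klPredsV12`) -/

/-- Gen 3 (`klPredsV11`, `H = histV10`, `Λang = angBar … 1`): the minimal-shape hypotheses are identity maps plus `TwoLegAngularG.abs_sub_le`
(the child of record is closed by `KLRegimeCounterterm.KLRegimeCountertermV11_of`). -/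
example : CountertermP2 klPredsV11 klWindowC :=
  countertermP2_of_minimalShape (Pr := klPredsV11) (fun L M _ _ G P Q R β U μ K j => histV10 L M G P Q R β U μ K j)
    (fun L M _ _ G P Q R β U μ K j => histV10 L M G P Q R β U μ K j ∧
      TwoLegStepG L M (histV10 L M G P Q R β U μ) G P Q R β U μ K j ∧ TwoLegSizesMS L M G Q R β U μ K j ∧
        TwoLegAngularG L M G Q R β U μ K j)
    (fun G _ Q R β U _ => angBar G Q R U (nScales β) 1)
    (fun _ _ _ _ _ h => h) (fun _ _ _ _ _ _ _ _ _ _ h => h) (fun _ _ _ _ _ _ _ _ _ _ _ _ _ hs hr he => ⟨hs, hr, he⟩)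
    (fun _ _ _ _ _ _ _ _ _ _ _ _ _ hh ht => ⟨hh, ht.1, ht.2.1, ht.2.2.1⟩)
    (fun _ _ _ _ _ _ _ _ _ _ _ _ _ h => ⟨h.1.1, h.1.2.2.1, h.2.1, fun a b => h.2.2.1.abs_sub_le a b, h.2.2.2⟩)

/-- **Gen 4 (`klPredsV12`, `H = histV12`, `Λang = angBar … 1`)**: the gen-4 Counterterm child's statement `CountertermP2 klPredsV12 klWindowC`
from the minimal shape (an `example`: the statement is landed once as a theorem, `CtE.countertermP2_klPredsV12`). -/
example : CountertermP2 klPredsV12 klWindowC :=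
  countertermP2_of_minimalShape (Pr := klPredsV12) (fun L M _ _ G P Q R β U μ K j => histV12 L M G P Q R β U μ K j)
    (fun L M _ _ G P Q R β U μ K j => histV12 L M G P Q R β U μ K j ∧
      TwoLegStepG L M (histV12 L M G P Q R β U μ) G P Q R β U μ K j ∧ TwoLegSizesMS L M G Q R β U μ K j ∧
        TwoLegAngularG L M G Q R β U μ K j)
    (fun G _ Q R β U _ => angBar G Q R U (nScales β) 1)
    (fun _ _ _ _ _ h => h) (fun _ _ _ _ _ _ _ _ _ _ h => h) (fun _ _ _ _ _ _ _ _ _ _ _ _ _ hs hr he => ⟨hs, hr, he⟩)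
    (fun _ _ _ _ _ _ _ _ _ _ _ _ _ hh ht => ⟨hh, ht.1, ht.2.1, ht.2.2.1⟩)
    (fun _ _ _ _ _ _ _ _ _ _ _ _ _ h => ⟨h.1.1, h.1.2.2.1, h.2.1, fun a b => h.2.2.1.abs_sub_le a b, h.2.2.2⟩)

end Summit.HubbardSuperconductivity.HubbardSuperconductivity.Theorems.KLRegimeSplit

end
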